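import Literature.NumberTheory.EllipticCurves.ModularCurve
import Literature.NumberTheory.EllipticCurves.AbelianVarietyBridge
import HarnessLib

/-!
# The modular Jacobian `J₀(N)` and multiplicity one for an elliptic curve of conductor `N`
# (named fact)

For an elliptic curve `E/ℚ` of conductor `N`, given by a globally minimal model `W`, the Jacobian
`J₀(N)` of the modular curve `X₀(N)` is an abelian variety over `ℚ` of dimension `g(X₀(N))`
(Shimura 1971, Thm. 7.14), and `Hom_ℚ(E, J₀(N)) = ℤ ι`, `Hom_ℚ(J₀(N), E) = ℤ π` with
`π ∘ ι = [m]`, `m` the least degree of a modular parametrisation `X₀(N) → E` — multiplicity one of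
the newform of `E` in `J₀(N)` and optimality of the strong Weil curve (Agashe–Ribet–Stein 2012,
§2.1 and §3: `J₀(N) ~ ∏ J_g^{e(g)}` with simple, pairwise non-isogenous `J_g`, and
`E₁^∨ → J₀(N) → E₁` "is multiplication by the modular degree"). This file records that statement as the named fact
`exists_modularJacobian_hom_generators` (`def … : Prop`, CONVENTIONS §4), phrased over the tree's
`ModularParametrizationData W N` (whose minimal-degree data are the parametrisations through the
optimal curve composed with a minimal isogeny, see the docstring) and
`Literature.AlgebraicGeometry.Motives.AbelianVariety ℚ` (proper geometrically integral `ℚ`-group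
schemes). It is not proved here: `X₀(N)` as a curve over `ℚ`, hence `J₀(N)` with its Hecke action,
the Eichler–Shimura construction and the optimal quotient are not constructed in the tree
(Mathlib has `Γ₀(N)`, cusp forms and `q`-expansions, but no modular curve as a scheme).

Consumer: `Summits/ABC/ABC/Theorems/IsogenyGlueCongruenceModularJacobianMultipliersOfFacts.lean`
(route IsogenyGlueCongruence of the `abc` summit: the "`E`-multipliers of `J₀(N)`" are the
multiples of the minimal modular degree).

## What is NOT here

* No construction of `J₀(N)`, no Hecke algebra, no statement for non-minimal models (false as
  stated for them: the admissible Manin constants shrink and the minimal degree grows), no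
  uniqueness of `(E, J, ι, π)`.
* The equality `dim J₀(N) = g(X₀(N))` uses the tree's closed genus formula `genusX0`
  (`ModularCurve.lean`; Shimura Prop. 1.40/1.43).

## References

* G. Shimura, *Introduction to the arithmetic theory of automorphic functions* (1971): Prop. 1.40,
  1.43, Thm. 7.14. [ShimuraIATAF1971]
* A. Agashe, K. Ribet, W. Stein, *The modular degree, congruence primes, and multiplicity one*,
  in: Number Theory, Analysis and Geometry (in memory of S. Lang), Springer (2012), §2.1, §3
  (Lemma 3.1, Def. 3.2). [AgasheRibetStein2012]
* G. Faltings, *Endlichkeitssätze für abelsche Varietäten über Zahlkörpern*, Invent. Math. 73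
  (1983), Kor. 2 zu Satz 4. [Faltings1983]
* B. Edixhoven, *On the Manin constants of modular elliptic curves* (1991), Prop. 2.
  [EdixhovenManin1991]
-/

noncomputable section

open CategoryTheory
open Literature.AlgebraicGeometry.Motives

namespace Literature.NumberTheory.EllipticCurves.ModularForms

/-- **The modular Jacobian `J₀(N)` and multiplicity one for an elliptic curve of conductor `N`**
(named fact, not proved in the tree). Let `W/ℚ` be a globally minimal Weierstrass model of an
elliptic curve of conductor `N = N_W`, and let `D` be a modular parametrisation datum of `W` at
level `N` (`ModularParametrizationData W N`: the newform `f` of `W`, the Néron lattice `Λ_E`, an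
integer `c` with `c Λ_f ⊆ Λ_E` and the degree `deg` of `φ_D : X₀(N) → E`, `τ ↦ c · 2πi ∫_{i∞}^τ f
(mod Λ_E)`) of MINIMAL degree among all data of `W` at level `N`. Then there are abelian varieties
`E`, `J` over `ℚ` (proper geometrically integral `ℚ`-group schemes,
`Literature.AlgebraicGeometry.Motives.AbelianVariety`), a `Γ_ℚ`-equivariant additive isomorphism
`E(ℚ̄) ≃ W(ℚ̄)` (so `E` is the curve `W` as an abelian variety), and homomorphisms `ι : E → J`,
`π : J → E` with `dim J = g(X₀(N))` (`genusX0 N`), `π ∘ ι = [deg φ_D]` on `E`,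
`Hom_ℚ(E, J) = ℤ ι` and `Hom_ℚ(J, E) = ℤ π`.

Provenance (standard; no single printed statement). `J = J₀(N)`, the Jacobian of `X₀(N)`, is an
abelian variety over `ℚ` of dimension `g(X₀(N)) = dim S₂(Γ₀(N))` (Shimura 1971, Thm. 7.14 with
§6–7 for the `ℚ`-structure; Prop. 1.40/1.43 for the genus, the tree's `genusX0`); `E = W` as the
smooth plane cubic (Silverman AEC III.3). Let `E₁ = J₀(N)/I_f J₀(N)` be the optimal quotient
attached to the newform `f = D.f` of `W`, `π₁ : J₀(N) → E₁` (connected kernel) and `m_{E₁}` its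
modular degree (Agashe–Ribet–Stein 2012, §2.1). Up to isogeny `J₀(N)` is the product of the
`J_g^{e(g)}` over the newforms `g` of level `N(g) ∣ N` up to Galois conjugation, `e(g)` the number
of divisors of `N/N(g)`, with the `J_g` simple over `ℚ` and pairwise non-isogenous (ARS 2012, §3,
before and in Lemma 3.1, from Shimura Thm. 7.14 and multiplicity one for newforms); `f` being new
of level exactly `N`, `E₁ ~ J_f` occurs once, so `Hom_ℚ(J₀(N), E₁) = ℤ π₁` (a homomorphism
`J₀(N) → E₁` is rationally a multiple of `π₁` and kills the connected kernel of `π₁`). `E₁` is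
`ℚ`-isogenous to `W` (same newform; Faltings), `Hom_ℚ(E₁, W) = ℤ ψ₀` for a minimal isogeny `ψ₀`
of degree `d₀` (`End_ℚ = ℤ`), so `Hom_ℚ(J₀(N), W) = ℤ (ψ₀ ∘ π₁) =: ℤ π` and dually (canonical
principal polarisations of `J₀(N)`, `E₁`, `W`; ARS §3) `Hom_ℚ(W, J₀(N)) = ℤ (π₁^∨ ∘ ψ̂₀) =: ℤ ι`,
with `π ∘ ι = ψ₀ ∘ (π₁ ∘ π₁^∨) ∘ ψ̂₀ = [m_{E₁} d₀]` because `π₁ ∘ π₁^∨ : E₁^∨ → J₀(N) → E₁` "is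
multiplication by the modular degree `m_E`" (ARS 2012, §3, paragraph after Def. 3.2). Finally
`m_{E₁} d₀` is the minimal degree of a datum:
`Λ_f` is the full lattice of periods of `2πi f dz` (`periodLattice`), so `ℂ/Λ_f ≅ E₁(ℂ)` with
`Λ_{E₁} = c₁ Λ_f` (`c₁ ∈ ℤ` the Manin constant of `E₁`, Edixhoven 1991, Prop. 2), and the data of
`W` at level `N` correspond to the isogenies `ψ = k ψ₀ : E₁ → W` (`k ∈ ℤ ∖ {0}`) through
`c = c₁ · (ψ^* ω_W / ω_{E₁})`, which is an integer for the globally minimal `W` (Néron mapping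
property), with `deg φ_D = m_{E₁} · deg ψ = m_{E₁} k² d₀`; the minimum `m_{E₁} d₀` is attained at
`ψ = ±ψ₀`. Stated for all elliptic `W` (the item uses the semistable case); `IsGloballyMinimal` is
essential (for a non-minimal model the admissible `c` shrink and the minimal degree grows).
[cite: ShimuraIATAF1971, Thm. 7.14]
[cite: AgasheRibetStein2012, §2.1 and §3 (Lemma 3.1, Def. 3.2 and the paragraph following it)]
[cite: Faltings1983, Kor. 2 zu Satz 4] [cite: EdixhovenManin1991, Prop. 2] -/
def exists_modularJacobian_hom_generators : Prop :=
  ∀ (W : WeierstrassCurve ℚ) [W.IsElliptic] [W.IsGloballyMinimal] [NeZero (W.conductorNorm ℤ)]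
    (D : ModularParametrizationData W (W.conductorNorm ℤ)),
    (∀ D' : ModularParametrizationData W (W.conductorNorm ℤ), D.modularDegree ≤ D'.modularDegree) →
    ∃ (E J : AbelianVariety.{0} ℚ) (e : E.geomPoints ≃+ W.geomPoints) (ι : E ⟶ J) (π : J ⟶ E),
      (∀ (σ : Field.absoluteGaloisGroup ℚ) (P : E.geomPoints), e (σ • P) = σ • e P) ∧
      J.dim = genusX0 (W.conductorNorm ℤ) ∧
      ι ≫ π = (D.modularDegree : ℤ) • 𝟙 E ∧
      (∀ α : E ⟶ J, ∃ b : ℤ, α = b • ι) ∧ (∀ β : J ⟶ E, ∃ a : ℤ, β = a • π)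

end Literature.NumberTheory.EllipticCurves.ModularForms

end
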